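import Summits.BirchSwinnertonDyer.BirchSwinnertonDyer.Theorems.ThetaPartnerAtTwoSignedKatoUpToAtTwoOffTwoOfPub
import HarnessLib

/-!
# Route `ThetaPartnerAtTwo` (TP2), crux K3 `SignedKatoDivisibilityUpToAtTwo` (item stmt-BirchSwinnertonDyer-20308),
# line `colemanrat` v3: **the ZETA-SPAN road** — K3 BY NAME modulo print from a `2`-adic package in the SHAPE
# OF THE PRINT (Kobayashi 2003 Thm. 6.2/6.3/7.3 ∕ Kato 2004 Thm. 12.5–12.6, as the tree's odd-`p` structure
# `Kobayashi2003.SignedColemanKatoData` records them): ONE Coleman map per curve, the zeta clause on the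
# `Λ`-SPAN of the genuine `2`-adic Euler-system classes; the passage to ONE genuine class is kernel algebra
# (width seat `bsd-wall-tp2-p2x-w3`; route-independent §1, any Noetherian domain)

HONEST FRAMING (cell `bsd-wall`): THEOREMS ONLY — no definition, no named fact, no instance, no `sorry`; the
K3-level theorems are CONDITIONAL on the displayed hypotheses (Kato Thm. 13.4 (2) at `p = 2` and Gross–Zagier–
Kolyvagin by name, def:Prop facts without `_holds`; one research package at `p = 2`); closes no item
(`proof.conditional`); BSD is NOT proved by any of this.

## Why this file (what it adds to `…OffTwoOfPub`)

The lead's weakest package (`signedKatoDivisibilityUpToAtTwo_of_weakPackageTwo_of_pub`) asks, PER dual datum `D`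
and PER height-one prime `𝔭 ∌ 2`, for a Coleman map `col`, maps `j`, `k`, and ONE genuine `2`-adic Euler-system
class `s` with `ℓ_𝔭(Λ/(col s)) ≤ ℓ_𝔭(Λ/(L♭))`. What the print delivers (and what a typer transcribing Kobayashi
§§6–7 ∕ Sprung 2012 §7 at `p = 2` would write, cloning `Kobayashi2003.SignedColemanKatoData`) is shaped
differently:
* ONE `Λ`-linear `col : 𝐇¹_Γ(T₂E) → P ≤ Λ` per curve and pinned `𝐇¹` («`Col⁺ ∘ loc₂`», Thm. 6.2), not per `(D, 𝔭)`;
* the Poitou–Tate maps `j : P → X⁺`, `k : X⁺ → X₀` per dual data `(D, Y)` ((7.17)–(7.21));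
* the zeta clause on a SUBMODULE: «`Col⁺(Z) ∋ L_p⁺` locally at `𝔭`» where `Z ⊂ 𝐇¹` is the `Λ`-span of Kato's
  zeta classes (Kato Thm. 12.6 `Z(f,T)`, Kobayashi Thm. 6.3 `Col(κ(z)) = L_p`, the structure field
  `image_zeta_localized : ∃ s ∉ 𝔭, s·G₁ ∈ col(Z) ∧ …` with `zeta_le_span : Z ≤ span {genuine classes}`) —
  an element of the SPAN of genuine classes is not itself a genuine class.
§2 proves that this print-shaped package implies the lead's, hence K3 (modulo the same two named facts):
the zeta clause on the span yields ONE genuine class `g` with `v_𝔭(col g) ≤ v_𝔭(L♭)` by the ultrametric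
inequality in the discrete valuation ring `Λ_𝔭` (§1: if `x ≠ 0` lies in the ideal generated by a set `S`, some
`g ∈ S` has `ℓ_𝔭(R/(g)) ≤ ℓ_𝔭(R/(x))` — `ord_𝔭` is a valuation). So the `p = 2` research input of line
`colemanrat` can be typed VERBATIM in the shape of the accepted odd-`p` structure, clause by clause, with the
single substitution `IsEulerSystemClass ↦ IsEulerSystemClassTwo`, the zeta clause read only at `𝔭 ∌ 2`, NO
`col_injective` (from GZK: `injective_col_of_gzk`) and NO surjectivity of `k`.

## What is proved

* §1 (any Noetherian domain `R`, height-one prime `𝔭 = (π)`): `exists_lengthAt_quotient_span_le_of_mem_span`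
  (ultrametric inequality for `ord_𝔭` over an arbitrary generating set), its UFD/height-one wrapper, the unit
  scaling `lengthAt_quotient_span_mul_eq_of_not_mem`, and the linear-map form
  `exists_lengthAt_quotient_span_apply_le_of_mem_span` (`z ∈ span G`, `c z ≠ 0` ⇒ some `g ∈ G` with
  `ℓ_𝔭(R/(c g)) ≤ ℓ_𝔭(R/(c z))`).
* §2 `signedKatoDivisibilityUpToAtTwo_of_zetaSpanPackageTwo_of_pub`: K3 by name from `h134`, `h17` and the
  PRINT-SHAPED package (length form of the zeta clause); `…_of_zetaSpanUnitPackageTwo_of_pub`: the same with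
  the zeta clause literally «`∃ s ∉ 𝔭, ∃ z ∈ span{genuine}, col z = s · L♭`».
* §3 (any `p`): `lengthAt_quotient_span_eq_of_iota_eq_C_ratCast_mul` — the period ratio is invisible off `p`:
  `ι G₁ = C(ϖ)·ι L`, `ϖ ∈ ℚˣ` ⇒ `ℓ_𝔭(Λ/(G₁)) = ℓ_𝔭(Λ/(L))` at every `𝔭 ∌ C(p)` (so a Néron-normalised zeta
  clause «`s·G₁ ∈ col(Z)`», as in the odd-`p` structure field `image_zeta_localized`, feeds (Z) in one line).
* §4 `signedKatoDivisibilityUpToAtTwo_of_zetaSpanNeronPackageTwo_of_pub`: K3 by name with the zeta clause in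
  Kobayashi's Néron normalisation «`∃ G₁, ι G₁ = C(2^m ϖ)·ι L♭ ∧ ∀ 𝔭 ∌ 2, ∃ s ∉ 𝔭, ∃ z ∈ span{genuine},
  col z = s · G₁`» — the literal `p = 2` reading of the `⊇` half of `image_zeta_localized`.

References: [Kobayashi2003] Thm. 6.2–6.3 (p. 11), (7.17)–(7.21), Thm. 7.3 (pp. 12–13); [Kato2004Asterisque]
Thm. 12.5 (3), Thm. 12.6 (p. 222), Thm. 13.4 (2) (p. 226), §13.8 (p. 228), §17.13 (p. 279); [Sprung2012] Def. 6.1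
(p. 1495), Remark 6.16, proof of Thm. 7.14 (p. 1504); [Darmon2004] Thm. 3.22; [Washington1997] §13.2.
-/

set_option autoImplicit false
-- the Theorems namespace of this sub repeats the summit name by design (D-0017 nested layout)
set_option linter.dupNamespace false

noncomputable section

open scoped Classical MatrixGroups ModularForm NumberField

open CongruenceSubgroup WeierstrassCurve Field IsDedekindDomain
  Literature.NumberTheory.GaloisRepresentations
  Literature.NumberTheory.EllipticCurves Literature.NumberTheory.EllipticCurves.ModularForms
  Literature.NumberTheory.EllipticCurves.Module Literature.NumberTheory.EllipticCurves.Rank1Residual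
  Literature.NumberTheory.EllipticCurves.Kobayashi2003 Literature.NumberTheory.EllipticCurves.Kato2004
  Literature.NumberTheory.EllipticCurves.Kato2004.EulerSystemValues ZpExtension
  Summit.BirchSwinnertonDyer.Rank1Residual.Supersingular
  Summit.BirchSwinnertonDyer.BirchSwinnertonDyer.Theses.ThetaPartnerAtTwo

namespace Summit.BirchSwinnertonDyer.BirchSwinnertonDyer.Theorems

namespace SignedKatoOffTwo

/-! ## §1 Commutative algebra: `ord_𝔭` is a valuation — the ultrametric inequality over a generating set -/

section Algebra

variable {R : Type*} [CommRing R] [IsDomain R]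

/-- **Ultrametric inequality for `ord_𝔭` over a generating set.** In a Noetherian domain, at a height-one prime
`𝔭 = (π)` generated by a prime element: if `x ≠ 0` lies in the ideal generated by a set `S`, then some `g ∈ S`
has `ℓ_𝔭(R/(g)) ≤ ℓ_𝔭(R/(x))` (i.e. `ord_π g ≤ ord_π x`). Proof: write `x = π^k a` with `π ∤ a`
(`WfDvdMonoid.max_power_factor`), so `ℓ_𝔭(R/(x)) = k`; if every `g ∈ S` had `ℓ_𝔭(R/(g)) > k` then
`π^{k+1} ∣ g` for all `g ∈ S` (`pow_dvd_of_le_lengthAt_quotient`), hence `π^{k+1} ∣ x`, `π ∣ a`. [folklore]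
[cite: Washington1997, §13.2] -/
theorem exists_lengthAt_quotient_span_le_of_mem_span [IsNoetherianRing R] {π : R} (hπ : Prime π)
    (𝔭 : PrimeSpectrum R) (h𝔭 : 𝔭.asIdeal = Ideal.span {π}) {S : Set R} {x : R}
    (hx : x ∈ Ideal.span S) (hx0 : x ≠ 0) :
    ∃ g ∈ S, lengthAt R (R ⧸ Ideal.span {g}) 𝔭 ≤ lengthAt R (R ⧸ Ideal.span {x}) 𝔭 := by
  by_contra! hlt
  obtain ⟨k, a, ha, rfl⟩ := WfDvdMonoid.max_power_factor hx0 hπ.irreducible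
  have hk : lengthAt R (R ⧸ Ideal.span {π ^ k * a}) 𝔭 = k :=
    lengthAt_quotient_span_singleton_pow_mul hπ k ha 𝔭 h𝔭
  have hdvd : ∀ g ∈ S, π ^ (k + 1) ∣ g := by
    intro g hg
    by_cases hg0 : g = 0
    · rw [hg0]; exact dvd_zero _
    refine pow_dvd_of_le_lengthAt_quotient hπ hg0 𝔭 h𝔭 ?_
    have h := hlt g hg
    rw [hk] at h
    rw [Nat.cast_succ]
    exact Order.add_one_le_of_lt h
  have hle : Ideal.span S ≤ Ideal.span {π ^ (k + 1)} :=
    Ideal.span_le.mpr fun g hg ↦ Ideal.mem_span_singleton.mpr (hdvd g hg)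
  have hx' : π ^ (k + 1) ∣ π ^ k * a := Ideal.mem_span_singleton.mp (hle hx)
  rw [pow_succ, mul_dvd_mul_iff_left (pow_ne_zero k hπ.ne_zero)] at hx'
  exact ha hx'

/-- A height-one prime of a Noetherian domain is not `⊥`. [folklore] -/
theorem primeSpectrum_asIdeal_ne_bot_of_height_eq_one (𝔭 : PrimeSpectrum R) (h𝔭 : 𝔭.asIdeal.height = 1) :
    𝔭.asIdeal ≠ ⊥ := by
  intro hbot
  have h0 : 𝔭.asIdeal.height = 0 := by rw [hbot]; exact Ideal.height_bot
  rw [h𝔭] at h0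
  exact one_ne_zero h0

/-- **Ultrametric inequality for `ord_𝔭`, UFD form**: in a Noetherian UFD every height-one prime is `(π)` for a
prime element `π` (`Ideal.IsPrime.exists_mem_prime_of_ne_bot`, `Ideal.eq_span_singleton_of_height_eq_one`), so
for `x ≠ 0` in the ideal generated by `S` some `g ∈ S` has `ℓ_𝔭(R/(g)) ≤ ℓ_𝔭(R/(x))`. [folklore]
[cite: Washington1997, §13.2] -/
theorem exists_lengthAt_quotient_span_le_of_mem_span_of_height_eq_one [IsNoetherianRing R]
    [UniqueFactorizationMonoid R] (𝔭 : PrimeSpectrum R) (h𝔭 : 𝔭.asIdeal.height = 1) {S : Set R} {x : R}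
    (hx : x ∈ Ideal.span S) (hx0 : x ≠ 0) :
    ∃ g ∈ S, lengthAt R (R ⧸ Ideal.span {g}) 𝔭 ≤ lengthAt R (R ⧸ Ideal.span {x}) 𝔭 := by
  obtain ⟨π, hπ𝔭, hπ⟩ := Ideal.IsPrime.exists_mem_prime_of_ne_bot 𝔭.isPrime
    (primeSpectrum_asIdeal_ne_bot_of_height_eq_one 𝔭 h𝔭)
  exact exists_lengthAt_quotient_span_le_of_mem_span hπ 𝔭
    (Ideal.eq_span_singleton_of_height_eq_one h𝔭 hπ𝔭 hπ) hx hx0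

/-- Scaling by an element OUTSIDE `𝔭` does not change `ℓ_𝔭(R/(x))`: `ℓ_𝔭(R/(s·x)) = ℓ_𝔭(R/(x))` for `s ∉ 𝔭`
(`s` is a unit of `R_𝔭`). [folklore] -/
theorem lengthAt_quotient_span_mul_eq_of_not_mem {s : R} (x : R) (𝔭 : PrimeSpectrum R)
    (hs : s ∉ 𝔭.asIdeal) :
    lengthAt R (R ⧸ Ideal.span {s * x}) 𝔭 = lengthAt R (R ⧸ Ideal.span {x}) 𝔭 := by
  have hs0 : s ≠ 0 := fun h ↦ hs (h ▸ 𝔭.asIdeal.zero_mem)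
  rw [lengthAt_quotient_span_singleton_mul x hs0 𝔭,
    lengthAt_quotient_eq_zero_of_not_le (I := Ideal.span {s}) (by rwa [Ideal.span_singleton_le_iff_mem]),
    zero_add]

variable {H P : Type*} [AddCommGroup H] [_root_.Module R H] [AddCommGroup P] [_root_.Module R P]

/-- **Ultrametric inequality along a linear map.** For `R`-linear `c : H → P`, `ι : P → R` (a Coleman map into a
submodule `P ≤ Λ` followed by the inclusion), a set `G ⊆ H` (the genuine Euler-system classes) and `z` in the
`R`-SPAN of `G` with `ι (c z) ≠ 0`: some `g ∈ G` has `ℓ_𝔭(R/(ι (c g))) ≤ ℓ_𝔭(R/(ι (c z)))` at every height-one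
prime `𝔭` of the Noetherian UFD `R` — because `ι (c z)` lies in the ideal generated by `ι (c '' G)`
(`Submodule.map_span`). This is the passage «Kato's `Z` / Kobayashi's `Col(Z)`» ↦ «ONE genuine class».
[cite: Kato2004Asterisque, Thm. 12.6 (p. 222) and Thm. 13.4 (p. 226)] [cite: Kobayashi2003, Thm. 6.3 (p. 11)] -/
theorem exists_lengthAt_quotient_span_apply_le_of_mem_span [IsNoetherianRing R] [UniqueFactorizationMonoid R]
    (c : H →ₗ[R] P) (ι : P →ₗ[R] R) (G : Set H) {z : H} (hz : z ∈ Submodule.span R G)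
    (hz0 : ι (c z) ≠ 0) (𝔭 : PrimeSpectrum R) (h𝔭 : 𝔭.asIdeal.height = 1) :
    ∃ g ∈ G, lengthAt R (R ⧸ Ideal.span {ι (c g)}) 𝔭 ≤ lengthAt R (R ⧸ Ideal.span {ι (c z)}) 𝔭 := by
  have hmem : ι (c z) ∈ Ideal.span ((fun h : H ↦ ι (c h)) '' G) := by
    have h1 : (ι ∘ₗ c) z ∈ Submodule.map (ι ∘ₗ c) (Submodule.span R G) := Submodule.mem_map_of_mem hz
    rw [Submodule.map_span] at h1
    exact h1
  obtain ⟨y, ⟨g, hg, rfl⟩, hle⟩ :=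
    exists_lengthAt_quotient_span_le_of_mem_span_of_height_eq_one 𝔭 h𝔭 hmem hz0
  exact ⟨g, hg, hle⟩

end Algebra

/-! ## §2 K3 BY NAME, modulo print, from the PRINT-SHAPED `2`-adic package (zeta clause on the span) -/

section AtTwo

/-- **K3 `SignedKatoDivisibilityUpToAtTwo` BY NAME, MODULO PRINT, from a `2`-adic Coleman–Poitou–Tate package
IN THE SHAPE OF THE PRINT.** Granted Kato Thm. 13.4 (2) at `p = 2` (`h134`) and Gross–Zagier–Kolyvagin (`h17`),
K3 follows if for every habitat datum (`E` non-CM, `r_an = 0`, good supersingular at `2`, `a₂ = 0`; cyclotomic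
`κ, γ` matching the variable; newform `f`, period ratio `ϖ`, Pollack pair `(L♯, L♭)` at `2`) there are a pinned
`I` (`𝐇¹_Γ(T₂E)`), a submodule `P ≤ Λ` and ONE `Λ`-linear `col : 𝐇¹_Γ(T₂E) → P` («`Col⁺ ∘ loc₂`», Kobayashi
Thm. 6.2 at `2`; no injectivity, no surjectivity asked) such that
(PT) for every dual datum `D` of `Sel⁺(E/ℚ_∞)` with `X⁺` torsion there are a pinned `Y` (`X₀(E/ℚ_∞)`) and
  `Λ`-linear `j : P → X⁺`, `k : X⁺ → X₀` with RECIPROCITY `j ∘ col = 0` and COVER `ker k ≤ range j` (the two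
  halves of (7.17)–(7.21) that the upper bound consumes), and
(Z) at every height-one `𝔭 ∌ 2` some `z` in the `Λ`-SPAN of the genuine `2`-adic Euler-system classes
  (`Kato2004.IsEulerSystemClassTwo`; Kato's `Z(f,T)` lies in this span, Thm. 12.6 / Ex. 13.3) has
  `ℓ_𝔭(Λ/(col z)) ≤ ℓ_𝔭(Λ/(L♭))` («`L_p⁺ ∈ Col⁺(Z)_𝔭`»: Kobayashi Thm. 6.3 ∕ Sprung Def. 6.1 + Remark 6.16 at
  `2`, Kato Thm. 12.5 `z_γ ∈ Z ⊗ ℚ` with the `(c,d)`-Euler factors `μ_{c,d}` generating the unit ideal of `Λ_𝔭`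
  over all admissible `(c,d)`, §13.9–13.12).
Proof: §1 turns (Z) into ONE genuine class `g` with `ℓ_𝔭(Λ/(col g)) ≤ ℓ_𝔭(Λ/(col z)) ≤ ℓ_𝔭(Λ/(L♭))` (so
`col g ≠ 0`, `g ≠ 0`: `ne_zero_of_lengthAt_quotient_span_le`), and the lead's
`signedKatoDivisibilityUpToAtTwo_of_weakPackageTwo_of_pub` concludes (injectivity of `col` and finiteness of
`ℓ_𝔭(𝐇¹/Λg)` from `h17` there). [cite: Kobayashi2003, Thm. 6.2–6.3 (p. 11), (7.17)–(7.21) and Thm. 7.3 (pp. 12–13)]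
[cite: Kato2004Asterisque, Thm. 12.5 (3) and Thm. 12.6 (p. 222), Thm. 13.4 (2) (p. 226), §13.8 (p. 228)]
[cite: Sprung2012, Def. 6.1 (p. 1495) and proof of Thm. 7.14 (p. 1504)] [cite: Darmon2004, Thm. 3.22] -/
theorem signedKatoDivisibilityUpToAtTwo_of_zetaSpanPackageTwo_of_pub
    (h134 : Kato2004.thm13_4_two_lengthAt_fineSelmerDual_le_of_isEulerSystemClassTwo)
    (h17 : rank_eq_analyticRank_of_analyticRank_le_one)
    (hCK : ∀ (W : WeierstrassCurve ℚ) [W.IsElliptic] [W.IsGloballyMinimal],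
      ¬ W.HasCM → W.analyticRank = 0 → GoodSS W 2 → W.frobeniusTrace 2 = 0 →
      ∀ (κ : ZpExtension ℚ 2) (γ : Field.absoluteGaloisGroup ℚ) (hκ : κ.IsCyclotomic),
        κ.IsTopGenerator γ → IsCyclotomicVariable 2 γ →
        ∀ [NeZero (W.conductorNorm ℤ)] (f : CuspForm (Gamma0 (W.conductorNorm ℤ)) 2),
          IsNewformOf W f → ∀ (ϖ : ℚ), (ϖ : ℝ) * W.realPeriodRat = plusPeriod f →
        ∀ (Lplus Lminus : IwasawaAlgebra 2), IsPollackPair f 2 Lplus Lminus →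
        ∀ [ContinuousSMul ℤ_[2] (W.tateModule 2)] [Module.Free ℤ_[2] (W.tateModule 2)]
          [Module.Finite ℤ_[2] (W.tateModule 2)],
        ∃ (I : Kato2004.IwasawaH1Data W 2 κ γ) (P : Submodule (IwasawaAlgebra 2) (IwasawaAlgebra 2))
          (col : I.H →ₗ[IwasawaAlgebra 2] P),
          (∀ (D : SignedSelmerDualData W κ γ 1), Module.IsTorsion (IwasawaAlgebra 2) D.X →
            ∃ (Y : W.FineSelmerDualData κ γ) (j : P →ₗ[IwasawaAlgebra 2] D.X)
              (k : D.X →ₗ[IwasawaAlgebra 2] Y.X),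
              (∀ x, j (col x) = 0) ∧ LinearMap.ker k ≤ LinearMap.range j) ∧
          (∀ 𝔭 : PrimeSpectrum (IwasawaAlgebra 2), 𝔭.asIdeal.height = 1 →
            PowerSeries.C (2 : ℤ_[2]) ∉ 𝔭.asIdeal →
            ∃ z ∈ Submodule.span (IwasawaAlgebra 2) {g : I.H | Kato2004.IsEulerSystemClassTwo W hκ I g},
              lengthAt (IwasawaAlgebra 2) (IwasawaAlgebra 2 ⧸ Ideal.span {(P.subtype (col z))}) 𝔭 ≤
                lengthAt (IwasawaAlgebra 2) (IwasawaAlgebra 2 ⧸ Ideal.span {kobayashiL 1 Lplus Lminus}) 𝔭)) :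
    SignedKatoDivisibilityUpToAtTwo := by
  refine signedKatoDivisibilityUpToAtTwo_of_weakPackageTwo_of_pub h134 h17
    fun W _ _ hcm hr hss ha κ γ hκ hγ hcv _ f hf ϖ hϖ Lplus Lminus hPP D _ _ _ hX 𝔭 h𝔭 hp𝔭 ↦ ?_
  obtain ⟨I, P, col, hPT, hZ⟩ := hCK W hcm hr hss ha κ γ hκ hγ hcv f hf ϖ hϖ Lplus Lminus hPP
  obtain ⟨Y, j, k, hcj, hjk⟩ := hPT D hX
  obtain ⟨z, hz, hzle⟩ := hZ 𝔭 h𝔭 hp𝔭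
  have hL : kobayashiL 1 Lplus Lminus ≠ 0 := by rw [kobayashiL, if_pos rfl]; exact hPP.2.1
  have hz0 : (P.subtype (col z) : IwasawaAlgebra 2) ≠ 0 := ne_zero_of_lengthAt_quotient_span_le hL 𝔭 h𝔭 hzle
  obtain ⟨g, hg, hgle⟩ :=
    exists_lengthAt_quotient_span_apply_le_of_mem_span col P.subtype _ hz hz0 𝔭 h𝔭
  have hg' : lengthAt (IwasawaAlgebra 2) (IwasawaAlgebra 2 ⧸ Ideal.span {(P.subtype (col g))}) 𝔭 ≤
      lengthAt (IwasawaAlgebra 2) (IwasawaAlgebra 2 ⧸ Ideal.span {kobayashiL 1 Lplus Lminus}) 𝔭 :=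
    hgle.trans hzle
  have hcg0 : (P.subtype (col g) : IwasawaAlgebra 2) ≠ 0 := ne_zero_of_lengthAt_quotient_span_le hL 𝔭 h𝔭 hg'
  have hg0 : g ≠ 0 := by
    rintro rfl
    exact hcg0 (by rw [map_zero, map_zero])
  exact ⟨I, Y, P, col, j, k, g, hcj, hjk, hg, hg0, hg'⟩

/-- **K3 BY NAME, MODULO PRINT, with the zeta clause LITERALLY as printed on ideals**: (Z') at every height-one
`𝔭 ∌ 2`, `∃ s ∉ 𝔭, ∃ z ∈ span{genuine classes}, col z = s · L♭` («`L♭ ∈ Col⁺(Z)` after localisation at `𝔭`»,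
the `⊇` half of the field `image_zeta_localized` of `Kobayashi2003.SignedColemanKatoData`, read with the
`2`-adic class predicate). Since `s` is a unit of `Λ_𝔭`, `ℓ_𝔭(Λ/(s·L♭)) = ℓ_𝔭(Λ/(L♭))` (§1) and the length form
(Z) of `signedKatoDivisibilityUpToAtTwo_of_zetaSpanPackageTwo_of_pub` holds with equality.
[cite: Kobayashi2003, Thm. 6.3 (p. 11) and Thm. 7.3 (p. 13)] [cite: Kato2004Asterisque, Thm. 12.5–12.6 (p. 222), Thm. 13.4 (2) (p. 226)]
[cite: Sprung2012, Def. 6.1 (p. 1495)] [cite: Darmon2004, Thm. 3.22] -/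
theorem signedKatoDivisibilityUpToAtTwo_of_zetaSpanUnitPackageTwo_of_pub
    (h134 : Kato2004.thm13_4_two_lengthAt_fineSelmerDual_le_of_isEulerSystemClassTwo)
    (h17 : rank_eq_analyticRank_of_analyticRank_le_one)
    (hCK : ∀ (W : WeierstrassCurve ℚ) [W.IsElliptic] [W.IsGloballyMinimal],
      ¬ W.HasCM → W.analyticRank = 0 → GoodSS W 2 → W.frobeniusTrace 2 = 0 →
      ∀ (κ : ZpExtension ℚ 2) (γ : Field.absoluteGaloisGroup ℚ) (hκ : κ.IsCyclotomic),
        κ.IsTopGenerator γ → IsCyclotomicVariable 2 γ →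
        ∀ [NeZero (W.conductorNorm ℤ)] (f : CuspForm (Gamma0 (W.conductorNorm ℤ)) 2),
          IsNewformOf W f → ∀ (ϖ : ℚ), (ϖ : ℝ) * W.realPeriodRat = plusPeriod f →
        ∀ (Lplus Lminus : IwasawaAlgebra 2), IsPollackPair f 2 Lplus Lminus →
        ∀ [ContinuousSMul ℤ_[2] (W.tateModule 2)] [Module.Free ℤ_[2] (W.tateModule 2)]
          [Module.Finite ℤ_[2] (W.tateModule 2)],
        ∃ (I : Kato2004.IwasawaH1Data W 2 κ γ) (P : Submodule (IwasawaAlgebra 2) (IwasawaAlgebra 2))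
          (col : I.H →ₗ[IwasawaAlgebra 2] P),
          (∀ (D : SignedSelmerDualData W κ γ 1), Module.IsTorsion (IwasawaAlgebra 2) D.X →
            ∃ (Y : W.FineSelmerDualData κ γ) (j : P →ₗ[IwasawaAlgebra 2] D.X)
              (k : D.X →ₗ[IwasawaAlgebra 2] Y.X),
              (∀ x, j (col x) = 0) ∧ LinearMap.ker k ≤ LinearMap.range j) ∧
          (∀ 𝔭 : PrimeSpectrum (IwasawaAlgebra 2), 𝔭.asIdeal.height = 1 →
            PowerSeries.C (2 : ℤ_[2]) ∉ 𝔭.asIdeal →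
            ∃ s : IwasawaAlgebra 2, s ∉ 𝔭.asIdeal ∧
              ∃ z ∈ Submodule.span (IwasawaAlgebra 2) {g : I.H | Kato2004.IsEulerSystemClassTwo W hκ I g},
                (P.subtype (col z) : IwasawaAlgebra 2) = s * kobayashiL 1 Lplus Lminus)) :
    SignedKatoDivisibilityUpToAtTwo := by
  refine signedKatoDivisibilityUpToAtTwo_of_zetaSpanPackageTwo_of_pub h134 h17
    fun W _ _ hcm hr hss ha κ γ hκ hγ hcv _ f hf ϖ hϖ Lplus Lminus hPP _ _ _ ↦ ?_
  obtain ⟨I, P, col, hPT, hZ⟩ := hCK W hcm hr hss ha κ γ hκ hγ hcv f hf ϖ hϖ Lplus Lminus hPP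
  refine ⟨I, P, col, hPT, fun 𝔭 h𝔭 hp𝔭 ↦ ?_⟩
  obtain ⟨s, hs, z, hz, hzs⟩ := hZ 𝔭 h𝔭 hp𝔭
  refine ⟨z, hz, le_of_eq ?_⟩
  rw [hzs, lengthAt_quotient_span_mul_eq_of_not_mem _ 𝔭 hs]

end AtTwo

/-! ## §3 The period ratio is invisible off `p`: Néron-normalised generators have the same local lengths -/

section PeriodRatio

variable {p : ℕ} [Fact p.Prime]

/-- A non-zero integer is a unit times a power of `p` in `ℤ_p`. [folklore] -/
private theorem exists_unit_mul_pow_eq_intCast' {n : ℤ} (hn : n ≠ 0) :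
    ∃ (u : ℤ_[p]ˣ) (b : ℕ), (n : ℤ_[p]) = (u : ℤ_[p]) * (p : ℤ_[p]) ^ b := by
  have hn' : (n : ℤ_[p]) ≠ 0 := Int.cast_ne_zero.mpr hn
  exact ⟨PadicInt.unitCoeff hn', (n : ℤ_[p]).valuation, PadicInt.unitCoeff_spec hn'⟩

/-- `ι(C c · x) = C c · ι x` for `c ∈ ℤ_p` (coefficientwise inclusion `Λ → ℚ_p⟦T⟧`). [folklore] -/
private theorem iota_C_mul' (c : ℤ_[p]) (x : IwasawaAlgebra p) :
    iwasawaToPowerSeries p (PowerSeries.C c * x) =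
      PowerSeries.C (c : ℚ_[p]) * iwasawaToPowerSeries p x := by
  rw [map_mul, PowerSeries.map_C]; rfl

/-- For a non-zero integer `m`, the constant `C(m) ∈ Λ = ℤ_p⟦T⟧` lies in no prime `𝔭 ∌ C(p)`
(`m = u · p^b` in `ℤ_p` with `u` a unit). [folklore] -/
theorem C_intCast_not_mem_of_C_not_mem {m : ℤ} (hm : m ≠ 0) (𝔭 : PrimeSpectrum (IwasawaAlgebra p))
    (hp𝔭 : PowerSeries.C (p : ℤ_[p]) ∉ 𝔭.asIdeal) :
    (PowerSeries.C (m : ℤ_[p]) : IwasawaAlgebra p) ∉ 𝔭.asIdeal := by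
  obtain ⟨u, b, hu⟩ := exists_unit_mul_pow_eq_intCast' (p := p) hm
  intro hmem
  rw [hu, map_mul, map_pow, map_natCast] at hmem
  have hunit : IsUnit (PowerSeries.C (u : ℤ_[p]) : IwasawaAlgebra p) := (Units.isUnit u).map PowerSeries.C
  rcases 𝔭.isPrime.mem_or_mem hmem with h | h
  · exact 𝔭.isPrime.ne_top (Ideal.eq_top_of_isUnit_mem _ h hunit)
  · have h' : (PowerSeries.C (p : ℤ_[p]) : IwasawaAlgebra p) ^ b ∈ 𝔭.asIdeal := by
      rwa [map_natCast]
    exact hp𝔭 (𝔭.isPrime.mem_of_pow_mem b h')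

/-- **The period ratio is invisible off `p`.** If `ι G₁ = C(ϖ) · ι L` in `ℚ_p⟦T⟧` for a non-zero RATIONAL `ϖ`
(Kobayashi's Néron normalisation `L_p^ε(E, X) = ϖ · L^ε(f)` of the signed `p`-adic `L`-function versus the
tree's `Ω⁺_f`-normalised Pollack function, (3.4)–(3.6)), then `ℓ_𝔭(Λ/(G₁)) = ℓ_𝔭(Λ/(L))` at every prime
`𝔭 ∌ C(p)` of `Λ`: clearing the denominator, `C(d) · G₁ = C(n) · L` in `Λ` with `C(n), C(d) ∉ 𝔭`.
[cite: Kobayashi2003, (3.4)–(3.6) (p. 7) and Thm. 6.3 (p. 11)] [cite: Kato2004Asterisque, §17.13 (p. 280)] -/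
theorem lengthAt_quotient_span_eq_of_iota_eq_C_ratCast_mul {G₁ L : IwasawaAlgebra p} {ϖ : ℚ} (hϖ : ϖ ≠ 0)
    (h : iwasawaToPowerSeries p G₁ = PowerSeries.C (ϖ : ℚ_[p]) * iwasawaToPowerSeries p L)
    (𝔭 : PrimeSpectrum (IwasawaAlgebra p)) (hp𝔭 : PowerSeries.C (p : ℤ_[p]) ∉ 𝔭.asIdeal) :
    lengthAt (IwasawaAlgebra p) (IwasawaAlgebra p ⧸ Ideal.span {G₁}) 𝔭 =
      lengthAt (IwasawaAlgebra p) (IwasawaAlgebra p ⧸ Ideal.span {L}) 𝔭 := by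
  set n : ℤ := ϖ.num with hndef
  set d : ℤ := (ϖ.den : ℤ) with hddef
  have hn : n ≠ 0 := Rat.num_ne_zero.mpr hϖ
  have hd : d ≠ 0 := Int.natCast_ne_zero.mpr ϖ.den_nz
  have hϖnd : (ϖ : ℚ_[p]) * ((d : ℤ_[p]) : ℚ_[p]) = ((n : ℤ_[p]) : ℚ_[p]) := by
    rw [PadicInt.coe_intCast, PadicInt.coe_intCast, hndef, hddef]
    have h1 := Rat.mul_den_eq_num ϖ
    exact_mod_cast congrArg (fun q : ℚ ↦ (q : ℚ_[p])) h1
  -- `C(d) · G₁ = C(n) · L` in `Λ` (apply the injective `ι`)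
  have key : (PowerSeries.C (d : ℤ_[p]) : IwasawaAlgebra p) * G₁ = PowerSeries.C (n : ℤ_[p]) * L := by
    apply iwasawaToPowerSeries_injective p
    rw [iota_C_mul', iota_C_mul', h, ← mul_assoc, ← map_mul, mul_comm ((d : ℤ_[p]) : ℚ_[p]), hϖnd]
  rw [← lengthAt_quotient_span_mul_eq_of_not_mem G₁ 𝔭 (C_intCast_not_mem_of_C_not_mem hd 𝔭 hp𝔭), key,
    lengthAt_quotient_span_mul_eq_of_not_mem L 𝔭 (C_intCast_not_mem_of_C_not_mem hn 𝔭 hp𝔭)]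

end PeriodRatio

/-! ## §4 K3 BY NAME from the print-shaped package with Kobayashi's NÉRON-normalised zeta clause -/

section Neron

/-- **K3 BY NAME, MODULO PRINT, zeta clause in Kobayashi's Néron normalisation** — the literal `p = 2` reading
of the `⊇` half of the field `image_zeta_localized` of `Kobayashi2003.SignedColemanKatoData`: for some `G₁ ∈ Λ`
with `ι G₁ = C(2^m · ϖ) · ι L♭` (Kobayashi's `L_p⁺(E, X) = ϖ · L⁺(f)`, (3.4)–(3.6), allowed a power of `2` so
that integrality is never an issue) and every height-one `𝔭 ∌ 2`: `∃ s ∉ 𝔭, ∃ z ∈ span{genuine classes},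
col z = s · G₁` («`L_p⁺(E,X) ∈ Col⁺(Z)_𝔭`», Thm. 6.3 with Kato Thm. 12.5–12.6). By §3 the period ratio and the
power of `2` are invisible at `𝔭 ∌ 2`, so this is (Z) of `signedKatoDivisibilityUpToAtTwo_of_zetaSpanPackageTwo_of_pub`.
[cite: Kobayashi2003, (3.4)–(3.6) (p. 7), Thm. 6.3 (p. 11), Thm. 7.3 (p. 13)] [cite: Kato2004Asterisque, Thm. 12.5–12.6 (p. 222), Thm. 13.4 (2) (p. 226)]
[cite: Sprung2012, Def. 6.1 (p. 1495)] [cite: Darmon2004, Thm. 3.22] -/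
theorem signedKatoDivisibilityUpToAtTwo_of_zetaSpanNeronPackageTwo_of_pub
    (h134 : Kato2004.thm13_4_two_lengthAt_fineSelmerDual_le_of_isEulerSystemClassTwo)
    (h17 : rank_eq_analyticRank_of_analyticRank_le_one)
    (hCK : ∀ (W : WeierstrassCurve ℚ) [W.IsElliptic] [W.IsGloballyMinimal],
      ¬ W.HasCM → W.analyticRank = 0 → GoodSS W 2 → W.frobeniusTrace 2 = 0 →
      ∀ (κ : ZpExtension ℚ 2) (γ : Field.absoluteGaloisGroup ℚ) (hκ : κ.IsCyclotomic),
        κ.IsTopGenerator γ → IsCyclotomicVariable 2 γ →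
        ∀ [NeZero (W.conductorNorm ℤ)] (f : CuspForm (Gamma0 (W.conductorNorm ℤ)) 2),
          IsNewformOf W f → ∀ (ϖ : ℚ), (ϖ : ℝ) * W.realPeriodRat = plusPeriod f →
        ∀ (Lplus Lminus : IwasawaAlgebra 2), IsPollackPair f 2 Lplus Lminus →
        ∀ [ContinuousSMul ℤ_[2] (W.tateModule 2)] [Module.Free ℤ_[2] (W.tateModule 2)]
          [Module.Finite ℤ_[2] (W.tateModule 2)],
        ∃ (I : Kato2004.IwasawaH1Data W 2 κ γ) (P : Submodule (IwasawaAlgebra 2) (IwasawaAlgebra 2))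
          (col : I.H →ₗ[IwasawaAlgebra 2] P),
          (∀ (D : SignedSelmerDualData W κ γ 1), Module.IsTorsion (IwasawaAlgebra 2) D.X →
            ∃ (Y : W.FineSelmerDualData κ γ) (j : P →ₗ[IwasawaAlgebra 2] D.X)
              (k : D.X →ₗ[IwasawaAlgebra 2] Y.X),
              (∀ x, j (col x) = 0) ∧ LinearMap.ker k ≤ LinearMap.range j) ∧
          (∃ (G₁ : IwasawaAlgebra 2) (m : ℕ),
            iwasawaToPowerSeries 2 G₁ =
              PowerSeries.C ((2 : ℚ_[2]) ^ m * (ϖ : ℚ_[2])) * iwasawaToPowerSeries 2 (kobayashiL 1 Lplus Lminus) ∧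
            ∀ 𝔭 : PrimeSpectrum (IwasawaAlgebra 2), 𝔭.asIdeal.height = 1 →
              PowerSeries.C (2 : ℤ_[2]) ∉ 𝔭.asIdeal →
              ∃ s : IwasawaAlgebra 2, s ∉ 𝔭.asIdeal ∧
                ∃ z ∈ Submodule.span (IwasawaAlgebra 2) {g : I.H | Kato2004.IsEulerSystemClassTwo W hκ I g},
                  (P.subtype (col z) : IwasawaAlgebra 2) = s * G₁)) :
    SignedKatoDivisibilityUpToAtTwo := by
  refine signedKatoDivisibilityUpToAtTwo_of_zetaSpanPackageTwo_of_pub h134 h17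
    fun W _ _ hcm hr hss ha κ γ hκ hγ hcv _ f hf ϖ hϖ Lplus Lminus hPP _ _ _ ↦ ?_
  obtain ⟨I, P, col, hPT, G₁, m, hG₁, hZ⟩ := hCK W hcm hr hss ha κ γ hκ hγ hcv f hf ϖ hϖ Lplus Lminus hPP
  refine ⟨I, P, col, hPT, fun 𝔭 h𝔭 hp𝔭 ↦ ?_⟩
  obtain ⟨s, hs, z, hz, hzs⟩ := hZ 𝔭 h𝔭 hp𝔭
  refine ⟨z, hz, le_of_eq ?_⟩
  -- `2^m · ϖ` is a non-zero rational, invisible off `2` (§3); `s` is a unit at `𝔭` (§1)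
  have hϖ0 : ϖ ≠ 0 := varpi_ne_zero hf hϖ
  have hq : ((2 : ℚ) ^ m * ϖ : ℚ) ≠ 0 := mul_ne_zero (pow_ne_zero m two_ne_zero) hϖ0
  have hG₁' : iwasawaToPowerSeries 2 G₁ =
      PowerSeries.C ((((2 : ℚ) ^ m * ϖ : ℚ)) : ℚ_[2]) * iwasawaToPowerSeries 2 (kobayashiL 1 Lplus Lminus) := by
    rw [hG₁]; push_cast; rfl
  have hp𝔭' : PowerSeries.C ((2 : ℕ) : ℤ_[2]) ∉ 𝔭.asIdeal := by simpa only [Nat.cast_ofNat] using hp𝔭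
  rw [hzs, lengthAt_quotient_span_mul_eq_of_not_mem _ 𝔭 hs,
    lengthAt_quotient_span_eq_of_iota_eq_C_ratCast_mul (p := 2) hq hG₁' 𝔭 hp𝔭']

end Neron

end SignedKatoOffTwo

end Summit.BirchSwinnertonDyer.BirchSwinnertonDyer.Theorems

end
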